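import Literature.NumberTheory.Automorphic.ArchCoordinatesGL
import Literature.NumberTheory.Automorphic.HarishChandraConvolutionGL
import Mathlib.MeasureTheory.Measure.Haar.Unique
import HarnessLib

/-!
# The Haar measure of `GL_n(K_∞)` in linear coordinates: `dν = c · |det L_x|⁻¹ dx`

Topic `NumberTheory/Automorphic`; sequel of `ArchCoordinatesGL` (linear coordinates
`glCoord : M_n(K_∞) ≃L ℝ^D`, the open set `glUnitSet` of coordinates of invertible matrices, the
pull-back `unitPull`, right multiplication `rFlow` and `integral_comp_rFlow`). Every Haar measure
on the unit group `GL_n(K_∞)` of the finite-dimensional real algebra `M_n(K_∞)` is, in linear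
coordinates, Lebesgue measure with the density `|det L_x|⁻¹` (`L_x` = left multiplication by `x` on
`M_n(K_∞)`), up to a positive constant (Bourbaki, *Intégration* VII §1 no. 10, Prop. 15 /
folklore: the Haar measure of the group of units of a finite-dimensional algebra). We prove:

* `lFlow h` — left multiplication by `h` in coordinates (the twin of `rFlow`), its algebra, and
  `integral_comp_lFlow` / `lintegral_comp_lFlow` (Lebesgue measure is rescaled by `|det|⁻¹`);
* `haarWeightGL s = |det (lFlow (matOf s))|`, continuous, positive on `glUnitSet`, and
  multiplicative: `haarWeightGL (lFlow g s) = |det (lFlow g)| · haarWeightGL s`;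
* `coordHaarGL n K` — the image on `GL_n(K_∞)` of the measure `haarWeightGL⁻¹ ds` on `glUnitSet`
  (definitions `coordDensityGL`, `coordMeasureGL`, `unitOfCoord`), with
  `lintegral_coordHaarGL` and **`integral_coordHaarGL`: `∫ f d(coordHaarGL) = ∫ unitPull f · haarWeightGL⁻¹ ds`**;
* `isMulLeftInvariant_coordHaarGL`, `isFiniteMeasureOnCompacts_coordHaarGL`,
  `coordHaarGL_univ_ne_zero` — it is a left invariant Radon measure, non-zero;
* `exists_integral_haar_eq_integral_unitPull` — **for every Haar measure `ν` on `GL_n(K_∞)` there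
  is `c > 0` with `∫ f dν = c ∫ unitPull f (s) · haarWeightGL(s)⁻¹ ds` for all continuous `f`**
  (uniqueness of Haar measure, Mathlib `Measure.isMulLeftInvariant_eq_smul`).

No named facts; the definitions are the coordinate objects listed above.

## References

* N. Bourbaki, *Intégration*, Ch. VII §1 no. 10 (Haar measure of the group of units of a
  finite-dimensional algebra) [folklore].
* A. Weil, *Basic Number Theory*, Ch. X §1 (measures on `GL_n` over local fields) [folklore].
-/

noncomputable section

open scoped MatrixGroups Matrix Topology Classical ENNReal NNReal
open Filter MeasureTheory NumberField NumberField.mixedEmbedding IsDedekindDomain Set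

namespace Literature.NumberTheory.Automorphic

-- `M_n(K_∞)` is finite-dimensional over `ℝ` (a theorem used as a local instance, as in
-- `ArchCoordinatesGL`)
attribute [local instance] finiteDimensional_matrix_mixedSpace

variable {n : ℕ} {K : Type} [Field K] [NumberField K]

/-! ### 1. Left translations as linear maps of the coordinate space -/

/-- **Left multiplication by `h ∈ M_n(K_∞)` in coordinates**, a real linear map of
`GlIdx n K → ℝ`. [folklore] -/
def lFlow (h : Matrix (Fin n) (Fin n) (mixedSpace K)) : (GlIdx n K → ℝ) →ₗ[ℝ] (GlIdx n K → ℝ) :=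
  (glCoord n K).toLinearEquiv.toLinearMap ∘ₗ LinearMap.mulLeft ℝ h ∘ₗ
    (glCoord n K).symm.toLinearEquiv.toLinearMap

/-- `matOf (lFlow h s) = h * matOf s`. [folklore] -/
@[simp] theorem matOf_lFlow (h : Matrix (Fin n) (Fin n) (mixedSpace K)) (s : GlIdx n K → ℝ) :
    matOf (lFlow h s) = h * matOf s := by
  simp [lFlow, matOf]

/-- `lFlow h s` in terms of `glCoord`. [folklore] -/
theorem lFlow_apply (h : Matrix (Fin n) (Fin n) (mixedSpace K)) (s : GlIdx n K → ℝ) :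
    lFlow h s = glCoord n K (h * matOf s) := by
  simp [lFlow, matOf]

/-- `lFlow 1 = id`. [folklore] -/
@[simp] theorem lFlow_one : lFlow (1 : Matrix (Fin n) (Fin n) (mixedSpace K)) = LinearMap.id :=
  LinearMap.ext fun s ↦ by rw [lFlow_apply, one_mul, LinearMap.id_apply, glCoord_matOf]

/-- `lFlow (h₁ h₂) = lFlow h₁ ∘ lFlow h₂` (a left action). [folklore] -/
theorem lFlow_mul (h₁ h₂ : Matrix (Fin n) (Fin n) (mixedSpace K)) :
    lFlow (h₁ * h₂) = lFlow h₁ ∘ₗ lFlow h₂ :=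
  LinearMap.ext fun s ↦ by
    rw [LinearMap.comp_apply, lFlow_apply, lFlow_apply, lFlow_apply, matOf_glCoord, mul_assoc]

/-- `lFlow g` for `g ∈ GL_n(K_∞)` as a linear equivalence (inverse `lFlow g⁻¹`). [folklore] -/
def lFlowEquiv (g : GL (Fin n) (mixedSpace K)) : (GlIdx n K → ℝ) ≃ₗ[ℝ] (GlIdx n K → ℝ) :=
  LinearEquiv.ofLinear (lFlow (g : Matrix (Fin n) (Fin n) (mixedSpace K)))
    (lFlow ((g⁻¹ : GL (Fin n) (mixedSpace K)) : Matrix (Fin n) (Fin n) (mixedSpace K)))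
    (by rw [← lFlow_mul, Units.mul_inv, lFlow_one])
    (by rw [← lFlow_mul, Units.inv_mul, lFlow_one])

/-- `lFlowEquiv g` is `lFlow g` as a linear map. [folklore] -/
@[simp] theorem coe_lFlowEquiv (g : GL (Fin n) (mixedSpace K)) :
    (lFlowEquiv g : (GlIdx n K → ℝ) →ₗ[ℝ] (GlIdx n K → ℝ)) =
      lFlow (g : Matrix (Fin n) (Fin n) (mixedSpace K)) :=
  rfl

/-- `det (lFlow g) ≠ 0` for `g ∈ GL_n(K_∞)`. [folklore] -/
theorem det_lFlow_ne_zero (g : GL (Fin n) (mixedSpace K)) :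
    LinearMap.det (lFlow (g : Matrix (Fin n) (Fin n) (mixedSpace K))) ≠ 0 := by
  rw [← coe_lFlowEquiv, ← LinearEquiv.coe_det]
  exact Units.ne_zero _

/-- `lFlow g` preserves `glUnitSet` for `g ∈ GL_n(K_∞)`, both ways. [folklore] -/
theorem lFlow_mem_glUnitSet_iff (g : GL (Fin n) (mixedSpace K)) (s : GlIdx n K → ℝ) :
    lFlow (g : Matrix (Fin n) (Fin n) (mixedSpace K)) s ∈ glUnitSet n K ↔ s ∈ glUnitSet n K := by
  rw [mem_glUnitSet_iff, mem_glUnitSet_iff, matOf_lFlow]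
  constructor
  · intro h
    have e : matOf s = ((g⁻¹ : GL (Fin n) (mixedSpace K)) : Matrix (Fin n) (Fin n) (mixedSpace K)) *
        ((g : Matrix (Fin n) (Fin n) (mixedSpace K)) * matOf s) := by
      rw [← mul_assoc, Units.inv_mul, one_mul]
    rw [e]
    exact (Units.isUnit _).mul h
  · intro h
    exact (Units.isUnit g).mul h

/-- The unit of `matOf (lFlow g s)` is `g` times the unit of `matOf s`. [folklore] -/
theorem glUnitChart_symm_matOf_lFlow (g : GL (Fin n) (mixedSpace K)) {s : GlIdx n K → ℝ}
    (hs : s ∈ glUnitSet n K) :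
    (glUnitChart n K).symm (matOf (lFlow (g : Matrix (Fin n) (Fin n) (mixedSpace K)) s)) =
      g * (glUnitChart n K).symm (matOf s) := by
  rw [matOf_lFlow]
  set u := (glUnitChart n K).symm (matOf s) with hu
  have hval : (u : Matrix (Fin n) (Fin n) (mixedSpace K)) = matOf s := coe_glUnitChart_symm hs
  rw [← hval, ← Units.val_mul, glUnitChart_symm_coe]

/-- `lFlow g` for `g ∈ GL_n(K_∞)` as a measurable equivalence of the coordinate space. [folklore] -/
def lFlowMeasurableEquiv (g : GL (Fin n) (mixedSpace K)) : (GlIdx n K → ℝ) ≃ᵐ (GlIdx n K → ℝ) :=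
  (lFlowEquiv g).toContinuousLinearEquiv.toHomeomorph.toMeasurableEquiv

/-- `lFlowMeasurableEquiv g` is `lFlow g` as a function. [folklore] -/
@[simp] theorem coe_lFlowMeasurableEquiv (g : GL (Fin n) (mixedSpace K)) :
    (lFlowMeasurableEquiv g : (GlIdx n K → ℝ) → (GlIdx n K → ℝ)) =
      lFlow (g : Matrix (Fin n) (Fin n) (mixedSpace K)) :=
  rfl

/-- **Lebesgue measure is rescaled by left translations** (`lintegral` form):
`∫⁻ F (lFlow g s) ds = |det (lFlow g)|⁻¹ ∫⁻ F`. [folklore] -/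
theorem lintegral_comp_lFlow (g : GL (Fin n) (mixedSpace K)) (F : (GlIdx n K → ℝ) → ℝ≥0∞) :
    ∫⁻ s, F (lFlow (g : Matrix (Fin n) (Fin n) (mixedSpace K)) s) =
      ENNReal.ofReal |(LinearMap.det (lFlow (g : Matrix (Fin n) (Fin n) (mixedSpace K))))⁻¹| *
        ∫⁻ s, F s := by
  have hdet := det_lFlow_ne_zero g
  have hmap := Measure.map_linearMap_addHaar_eq_smul_addHaar
    (μ := (volume : Measure (GlIdx n K → ℝ))) hdet
  have h1 := lintegral_map_equiv F (μ := (volume : Measure (GlIdx n K → ℝ))) (lFlowMeasurableEquiv g)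
  rw [coe_lFlowMeasurableEquiv] at h1
  rw [← h1]
  change ∫⁻ y, F y ∂(Measure.map (lFlow (g : Matrix (Fin n) (Fin n) (mixedSpace K))) volume) = _
  rw [hmap, lintegral_smul_measure, smul_eq_mul]

/-! ### 2. The Haar weight `|det L_x|` -/

variable (n K) in
/-- The Haar weight in coordinates: `haarWeightGL s = |det (lFlow (matOf s))|`, the modulus of the
determinant of left multiplication by the matrix with coordinates `s`, acting on `M_n(K_∞)`.
[folklore] -/
def haarWeightGL (s : GlIdx n K → ℝ) : ℝ :=
  |LinearMap.det (lFlow (n := n) (K := K) (matOf s))|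

/-- `0 ≤ haarWeightGL s`. [folklore] -/
theorem haarWeightGL_nonneg (s : GlIdx n K → ℝ) : 0 ≤ haarWeightGL n K s := abs_nonneg _

/-- The weight is positive on the units. [folklore] -/
theorem haarWeightGL_pos {s : GlIdx n K → ℝ} (hs : s ∈ glUnitSet n K) : 0 < haarWeightGL n K s := by
  obtain ⟨u, hu⟩ := (mem_glUnitSet_iff s).1 hs
  rw [haarWeightGL, ← hu]
  exact abs_pos.2 (det_lFlow_ne_zero u)

/-- **Multiplicativity**: `haarWeightGL (lFlow g s) = |det (lFlow g)| · haarWeightGL s`. [folklore] -/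
theorem haarWeightGL_lFlow (g : GL (Fin n) (mixedSpace K)) (s : GlIdx n K → ℝ) :
    haarWeightGL n K (lFlow (g : Matrix (Fin n) (Fin n) (mixedSpace K)) s) =
      |LinearMap.det (lFlow (g : Matrix (Fin n) (Fin n) (mixedSpace K)))| * haarWeightGL n K s := by
  rw [haarWeightGL, haarWeightGL, matOf_lFlow, lFlow_mul, LinearMap.det_comp, abs_mul]

/-- `det (lFlow h) = det (mulLeft h)` (conjugation invariance of the determinant). [folklore] -/
theorem det_lFlow_eq (h : Matrix (Fin n) (Fin n) (mixedSpace K)) :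
    LinearMap.det (lFlow (n := n) (K := K) h) =
      LinearMap.det (LinearMap.mulLeft ℝ h : Matrix (Fin n) (Fin n) (mixedSpace K) →ₗ[ℝ] _) := by
  have e : lFlow (n := n) (K := K) h =
      ((glCoord n K).toLinearEquiv : Matrix (Fin n) (Fin n) (mixedSpace K) →ₗ[ℝ] (GlIdx n K → ℝ)) ∘ₗ
        LinearMap.mulLeft ℝ h ∘ₗ
        ((glCoord n K).toLinearEquiv.symm : (GlIdx n K → ℝ) →ₗ[ℝ] Matrix (Fin n) (Fin n) (mixedSpace K)) := rfl
  rw [e, LinearMap.det_conj]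

/-- **The weight is continuous** (a polynomial in the coordinates). [folklore] -/
theorem continuous_haarWeightGL : Continuous (haarWeightGL n K) := by
  unfold haarWeightGL
  refine continuous_abs.comp ?_
  simp_rw [det_lFlow_eq]
  set b := glInfBasis n K with hb
  have e : ∀ h : Matrix (Fin n) (Fin n) (mixedSpace K),
      LinearMap.det (LinearMap.mulLeft ℝ h : Matrix (Fin n) (Fin n) (mixedSpace K) →ₗ[ℝ] _) =
        (LinearMap.toMatrix b b (LinearMap.mulLeft ℝ h)).det := fun h =>
    (LinearMap.det_toMatrix b _).symm
  simp_rw [e]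
  refine Continuous.matrix_det ?_
  -- `s ↦ toMatrix b b (mulLeft (matOf s))` is a linear map of finite-dimensional spaces
  let Φ : (GlIdx n K → ℝ) →ₗ[ℝ] Matrix (GlIdx n K) (GlIdx n K) ℝ :=
    (LinearMap.toMatrix b b).toLinearMap ∘ₗ (LinearMap.mul ℝ (Matrix (Fin n) (Fin n) (mixedSpace K))) ∘ₗ
      (glCoord n K).symm.toLinearEquiv.toLinearMap
  have hΦ : ∀ s, Φ s = LinearMap.toMatrix b b (LinearMap.mulLeft ℝ (matOf s)) := fun s => rfl
  simp_rw [← hΦ]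
  exact Φ.continuous_of_finiteDimensional

/-! ### 3. The coordinate model of Haar measure -/

variable (n K) in
/-- The density `haarWeightGL⁻¹` as an `ℝ≥0∞`-valued function. [folklore] -/
def coordDensityGL (s : GlIdx n K → ℝ) : ℝ≥0∞ := ENNReal.ofReal (haarWeightGL n K s)⁻¹

variable (n K) in
/-- The measure `haarWeightGL⁻¹ ds` on the set of coordinates of invertible matrices. [folklore] -/
def coordMeasureGL : Measure (GlIdx n K → ℝ) :=
  ((volume : Measure (GlIdx n K → ℝ)).restrict (glUnitSet n K)).withDensity (coordDensityGL n K)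

variable (n K) in
/-- The unit with coordinates `s` (junk off `glUnitSet`). [folklore] -/
def unitOfCoord (s : GlIdx n K → ℝ) : GL (Fin n) (mixedSpace K) := (glUnitChart n K).symm (matOf s)

/-- Measurability of the density. [folklore] -/
theorem measurable_coordDensityGL : Measurable (coordDensityGL n K) :=
  ENNReal.measurable_ofReal.comp (continuous_haarWeightGL.measurable.inv)

/-- `unitOfCoord` is continuous on `glUnitSet`. [folklore] -/
theorem continuousOn_unitOfCoord : ContinuousOn (unitOfCoord n K) (glUnitSet n K) :=
  continuousOn_glUnitChart_symm_matOf

/-- The coordinates of `unitOfCoord s` are `s`, on `glUnitSet`. [folklore] -/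
theorem glCoord_unitOfCoord {s : GlIdx n K → ℝ} (hs : s ∈ glUnitSet n K) :
    glCoord n K (unitOfCoord n K s : Matrix (Fin n) (Fin n) (mixedSpace K)) = s := by
  rw [unitOfCoord, coe_glUnitChart_symm hs, glCoord_matOf]

/-- `unitOfCoord (glCoord g) = g`. [folklore] -/
@[simp] theorem unitOfCoord_glCoord (g : GL (Fin n) (mixedSpace K)) :
    unitOfCoord n K (glCoord n K (g : Matrix (Fin n) (Fin n) (mixedSpace K))) = g := by
  rw [unitOfCoord, matOf_glCoord, glUnitChart_symm_coe]

/-- `unitPull f = f ∘ unitOfCoord` on `glUnitSet`. [folklore] -/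
theorem unitPull_eq_indicator (f : GL (Fin n) (mixedSpace K) → ℂ) :
    unitPull f = (glUnitSet n K).indicator (f ∘ unitOfCoord n K) := rfl

variable [MeasurableSpace (GL (Fin n) (mixedSpace K))] [BorelSpace (GL (Fin n) (mixedSpace K))]

/-- `unitOfCoord` is a.e. measurable for the coordinate measure (continuous on the open set
carrying it). [folklore] -/
theorem aemeasurable_unitOfCoord : AEMeasurable (unitOfCoord n K) (coordMeasureGL n K) := by
  have h1 : AEMeasurable (unitOfCoord n K) ((volume : Measure (GlIdx n K → ℝ)).restrict (glUnitSet n K)) :=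
    continuousOn_unitOfCoord.aemeasurable isOpen_glUnitSet.measurableSet
  exact h1.mono_ac (withDensity_absolutelyContinuous _ _)

variable (n K) in
/-- **The coordinate model of the Haar measure of `GL_n(K_∞)`**: the image on the group of the
measure `haarWeightGL⁻¹ ds` on `glUnitSet`. [folklore] -/
def coordHaarGL : Measure (GL (Fin n) (mixedSpace K)) := Measure.map (unitOfCoord n K) (coordMeasureGL n K)

/-! ### 4. Integration formulas -/

/-- **`∫⁻ f d(coordHaarGL) = ∫⁻_{glUnitSet} f (unitOfCoord s) · haarWeightGL(s)⁻¹ ds`.** [folklore] -/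
theorem lintegral_coordHaarGL {f : GL (Fin n) (mixedSpace K) → ℝ≥0∞} (hf : Measurable f) :
    ∫⁻ x, f x ∂coordHaarGL n K =
      ∫⁻ s in glUnitSet n K, f (unitOfCoord n K s) * coordDensityGL n K s := by
  rw [coordHaarGL, lintegral_map' hf.aemeasurable aemeasurable_unitOfCoord, coordMeasureGL]
  change ∫⁻ a, (f ∘ unitOfCoord n K) a ∂_ = _
  rw [lintegral_withDensity_eq_lintegral_mul₀ measurable_coordDensityGL.aemeasurable
      (hf.comp_aemeasurable (continuousOn_unitOfCoord.aemeasurable isOpen_glUnitSet.measurableSet))]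
  refine lintegral_congr fun s => ?_
  simp only [Pi.mul_apply, Function.comp_apply, mul_comm]

/-- The measure of a set: `coordHaarGL A = ∫⁻_{glUnitSet ∩ unitOfCoord⁻¹ A} haarWeightGL⁻¹`.
[folklore] -/
theorem coordHaarGL_apply {A : Set (GL (Fin n) (mixedSpace K))} (hA : MeasurableSet A) :
    coordHaarGL n K A = ∫⁻ s in glUnitSet n K, A.indicator 1 (unitOfCoord n K s) * coordDensityGL n K s := by
  rw [← lintegral_indicator_one hA, lintegral_coordHaarGL (measurable_one.indicator hA)]

/-- **`∫ f d(coordHaarGL) = ∫ unitPull f (s) · haarWeightGL(s)⁻¹ ds`** for continuous `f`.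
[folklore] -/
theorem integral_coordHaarGL {f : GL (Fin n) (mixedSpace K) → ℂ} (hf : Continuous f) :
    ∫ x, f x ∂coordHaarGL n K = ∫ s, unitPull f s * (((haarWeightGL n K s)⁻¹ : ℝ) : ℂ) := by
  have hfm : AEStronglyMeasurable f (coordHaarGL n K) := hf.aestronglyMeasurable
  rw [coordHaarGL, integral_map aemeasurable_unitOfCoord (by rwa [← coordHaarGL]), coordMeasureGL,
    integral_withDensity_eq_integral_toReal_smul₀ measurable_coordDensityGL.aemeasurable
      (Eventually.of_forall fun s => ENNReal.ofReal_lt_top),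
    ← integral_indicator isOpen_glUnitSet.measurableSet]
  refine integral_congr_ae (Eventually.of_forall fun s => ?_)
  show _ = unitPull f s * (((haarWeightGL n K s)⁻¹ : ℝ) : ℂ)
  by_cases hs : s ∈ glUnitSet n K
  · rw [indicator_of_mem hs, unitPull_of_mem f hs, coordDensityGL,
      ENNReal.toReal_ofReal (inv_nonneg.2 (haarWeightGL_nonneg s)), RCLike.real_smul_eq_coe_mul,
      mul_comm]
    rfl
  · rw [indicator_of_notMem hs, unitPull_of_not_mem f hs, zero_mul]

/-! ### 5. Left invariance, finiteness on compacts, non-triviality -/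

omit [MeasurableSpace (GL (Fin n) (mixedSpace K))] [BorelSpace (GL (Fin n) (mixedSpace K))] in
/-- `unitOfCoord (lFlow g s) = g * unitOfCoord s` on `glUnitSet`. [folklore] -/
theorem unitOfCoord_lFlow (g : GL (Fin n) (mixedSpace K)) {s : GlIdx n K → ℝ} (hs : s ∈ glUnitSet n K) :
    unitOfCoord n K (lFlow (g : Matrix (Fin n) (Fin n) (mixedSpace K)) s) = g * unitOfCoord n K s :=
  glUnitChart_symm_matOf_lFlow g hs

omit [MeasurableSpace (GL (Fin n) (mixedSpace K))] [BorelSpace (GL (Fin n) (mixedSpace K))] in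
/-- The density transforms inversely to the weight:
`coordDensityGL s = |det (lFlow g)| · coordDensityGL (lFlow g s)` on `glUnitSet`. [folklore] -/
theorem coordDensityGL_eq_mul_lFlow (g : GL (Fin n) (mixedSpace K)) {s : GlIdx n K → ℝ}
    (hs : s ∈ glUnitSet n K) :
    coordDensityGL n K s =
      ENNReal.ofReal |LinearMap.det (lFlow (g : Matrix (Fin n) (Fin n) (mixedSpace K)))| *
        coordDensityGL n K (lFlow (g : Matrix (Fin n) (Fin n) (mixedSpace K)) s) := by
  rw [coordDensityGL, coordDensityGL, haarWeightGL_lFlow, ← ENNReal.ofReal_mul (abs_nonneg _)]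
  congr 1
  have hw : 0 < haarWeightGL n K s := haarWeightGL_pos hs
  have hd : 0 < |LinearMap.det (lFlow (g : Matrix (Fin n) (Fin n) (mixedSpace K)))| :=
    abs_pos.2 (det_lFlow_ne_zero g)
  field_simp

/-- **`coordHaarGL` is left invariant.** [folklore] -/
theorem isMulLeftInvariant_coordHaarGL : (coordHaarGL n K).IsMulLeftInvariant := by
  refine ⟨fun g => Measure.ext fun A hA => ?_⟩
  rw [Measure.map_apply (measurable_const_mul g) hA, coordHaarGL_apply (measurable_const_mul g hA),
    coordHaarGL_apply hA]
  set L := lFlow (g : Matrix (Fin n) (Fin n) (mixedSpace K)) with hL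
  set c : ℝ≥0∞ := ENNReal.ofReal |LinearMap.det L| with hc
  -- the integrand on the left is `c ·` the integrand on the right composed with `L`
  set F : (GlIdx n K → ℝ) → ℝ≥0∞ := fun s =>
    (glUnitSet n K).indicator (fun s => A.indicator 1 (unitOfCoord n K s) * coordDensityGL n K s) s
    with hF
  have hleft : ∀ s, (glUnitSet n K).indicator
      (fun s => ((g * ·) ⁻¹' A).indicator 1 (unitOfCoord n K s) * coordDensityGL n K s) s =
        c * F (L s) := by
    intro s
    by_cases hs : s ∈ glUnitSet n K
    · have hs' : L s ∈ glUnitSet n K := (lFlow_mem_glUnitSet_iff g s).2 hs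
      have eF : F (L s) = A.indicator 1 (unitOfCoord n K (L s)) * coordDensityGL n K (L s) := by
        simp only [hF, indicator_of_mem hs']
      have e : ((g * ·) ⁻¹' A).indicator (1 : GL (Fin n) (mixedSpace K) → ℝ≥0∞) (unitOfCoord n K s) =
          A.indicator 1 (g * unitOfCoord n K s) := by
        simp only [indicator, mem_preimage, Pi.one_apply]
      rw [indicator_of_mem hs, eF, e, hL, unitOfCoord_lFlow g hs, coordDensityGL_eq_mul_lFlow g hs, hc]
      ring
    · have hs' : L s ∉ glUnitSet n K := fun h => hs ((lFlow_mem_glUnitSet_iff g s).1 h)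
      have eF : F (L s) = 0 := by simp only [hF, indicator_of_notMem hs']
      rw [indicator_of_notMem hs, eF, mul_zero]
  rw [← lintegral_indicator isOpen_glUnitSet.measurableSet,
    ← lintegral_indicator isOpen_glUnitSet.measurableSet]
  simp_rw [hleft]
  rw [lintegral_const_mul' _ _ ENNReal.ofReal_ne_top, lintegral_comp_lFlow g F, ← mul_assoc,
    ← ENNReal.ofReal_mul (abs_nonneg _), abs_inv,
    mul_inv_cancel₀ (abs_ne_zero.2 (det_lFlow_ne_zero g)), ENNReal.ofReal_one, one_mul]

/-- **`coordHaarGL` is finite on compact sets.** [folklore] -/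
theorem isFiniteMeasureOnCompacts_coordHaarGL : IsFiniteMeasureOnCompacts (coordHaarGL n K) := by
  refine ⟨fun C hC => ?_⟩
  rw [coordHaarGL_apply hC.measurableSet]
  -- the coordinates of `C`, a compact subset of `glUnitSet`, on which the density is bounded
  set C' : Set (GlIdx n K → ℝ) := (fun g : GL (Fin n) (mixedSpace K) =>
    glCoord n K (g : Matrix (Fin n) (Fin n) (mixedSpace K))) '' C with hC'
  have hC'c : IsCompact C' := hC.image ((glCoord n K).continuous.comp Units.continuous_val)
  have hC'U : C' ⊆ glUnitSet n K := by
    rintro _ ⟨g, _, rfl⟩; exact glCoord_coe_mem_glUnitSet g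
  have hcont : ContinuousOn (fun s => (haarWeightGL n K s)⁻¹) C' :=
    continuous_haarWeightGL.continuousOn.inv₀ fun s hs => (haarWeightGL_pos (hC'U hs)).ne'
  obtain ⟨B, hB⟩ := hC'c.exists_bound_of_continuousOn hcont
  have hle : ∀ s ∈ glUnitSet n K, C.indicator 1 (unitOfCoord n K s) * coordDensityGL n K s ≤
      C'.indicator (fun _ => ENNReal.ofReal B) s := by
    intro s hs
    by_cases hsC : unitOfCoord n K s ∈ C
    · have hs' : s ∈ C' := ⟨unitOfCoord n K s, hsC, glCoord_unitOfCoord hs⟩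
      rw [indicator_of_mem hsC, indicator_of_mem hs', Pi.one_apply, one_mul, coordDensityGL]
      exact ENNReal.ofReal_le_ofReal ((le_abs_self _).trans (by simpa using hB s hs'))
    · rw [indicator_of_notMem hsC, zero_mul]; exact bot_le
  calc ∫⁻ s in glUnitSet n K, C.indicator 1 (unitOfCoord n K s) * coordDensityGL n K s
      ≤ ∫⁻ s in glUnitSet n K, C'.indicator (fun _ => ENNReal.ofReal B) s :=
        setLIntegral_mono (measurable_const.indicator hC'c.measurableSet) hle
    _ ≤ ∫⁻ s, C'.indicator (fun _ => ENNReal.ofReal B) s := lintegral_mono' Measure.restrict_le_self le_rfl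
    _ = ENNReal.ofReal B * volume C' := lintegral_indicator_const hC'c.measurableSet _
    _ < ⊤ := ENNReal.mul_lt_top ENNReal.ofReal_lt_top hC'c.measure_lt_top

/-- `coordHaarGL ≠ 0` (the density is positive on the non-empty open set `glUnitSet`).
[folklore] -/
theorem coordHaarGL_univ_ne_zero : coordHaarGL n K Set.univ ≠ 0 := by
  rw [coordHaarGL_apply MeasurableSet.univ]
  simp only [indicator_univ, Pi.one_apply, one_mul]
  intro h
  have hae := (setLIntegral_eq_zero_iff isOpen_glUnitSet.measurableSet measurable_coordDensityGL).1 h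
  have hne : (glUnitSet n K).Nonempty := ⟨_, glCoord_coe_mem_glUnitSet (1 : GL (Fin n) (mixedSpace K))⟩
  have hpos : 0 < (volume : Measure (GlIdx n K → ℝ)) (glUnitSet n K) := isOpen_glUnitSet.measure_pos _ hne
  have hzero : (volume : Measure (GlIdx n K → ℝ)) (glUnitSet n K) = 0 := by
    rw [measure_eq_zero_iff_ae_notMem]
    filter_upwards [hae] with s hs hsU
    have h0 := hs hsU
    rw [coordDensityGL, ENNReal.ofReal_eq_zero] at h0
    exact absurd h0 (not_le.2 (inv_pos.2 (haarWeightGL_pos hsU)))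
  exact hpos.ne' hzero

/-! ### 6. Comparison with an arbitrary Haar measure -/

/-- **Every Haar measure on `GL_n(K_∞)` is `c · haarWeightGL⁻¹ ds` in coordinates**: for a Haar
measure `ν` there is `c > 0` with `∫ f dν = c ∫ unitPull f (s) · haarWeightGL(s)⁻¹ ds` for every
continuous `f : GL_n(K_∞) → ℂ` (uniqueness of Haar measure applied to the
left invariant Radon measure `coordHaarGL`, and `integral_coordHaarGL`). Bourbaki, *Intégration*
VII §1 no. 10. [folklore] -/
theorem exists_integral_haar_eq_integral_unitPull (ν : Measure (GL (Fin n) (mixedSpace K)))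
    [ν.IsHaarMeasure] :
    ∃ c : ℝ, 0 < c ∧ ∀ f : GL (Fin n) (mixedSpace K) → ℂ, Continuous f →
      ∫ x, f x ∂ν = (c : ℂ) * ∫ s, unitPull f s * (((haarWeightGL n K s)⁻¹ : ℝ) : ℂ) := by
  haveI : LocallyCompactSpace (GL (Fin n) (mixedSpace K)) := locallyCompactSpace_glInf n K
  haveI : SecondCountableTopology (GL (Fin n) (mixedSpace K)) := secondCountableTopology_glInf n K
  haveI : IsFiniteMeasureOnCompacts (coordHaarGL n K) := isFiniteMeasureOnCompacts_coordHaarGL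
  haveI : (coordHaarGL n K).IsMulLeftInvariant := isMulLeftInvariant_coordHaarGL
  have heq : coordHaarGL n K = Measure.haarScalarFactor (coordHaarGL n K) ν • ν :=
    Measure.isMulLeftInvariant_eq_smul _ _
  set c : ℝ≥0 := Measure.haarScalarFactor (coordHaarGL n K) ν with hc
  have hc0 : c ≠ 0 := by
    intro h0
    apply coordHaarGL_univ_ne_zero (n := n) (K := K)
    rw [heq, h0]
    simp
  have hcpos : 0 < (c : ℝ) := NNReal.coe_pos.2 (pos_iff_ne_zero.2 hc0)
  refine ⟨(c : ℝ)⁻¹, inv_pos.2 hcpos, fun f hf => ?_⟩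
  have h1 : ∫ x, f x ∂coordHaarGL n K = ((c : ℝ) : ℂ) * ∫ x, f x ∂ν := by
    rw [heq, integral_smul_nnreal_measure, NNReal.smul_def, Complex.real_smul]
  rw [← integral_coordHaarGL hf, h1, ← mul_assoc]
  have hcC : ((c : ℝ) : ℂ) ≠ 0 := Complex.ofReal_ne_zero.2 hcpos.ne'
  rw [show (((c : ℝ)⁻¹ : ℝ) : ℂ) * ((c : ℝ) : ℂ) = 1 by push_cast; field_simp, one_mul]

end Literature.NumberTheory.Automorphic
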